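import Summits.AtomisticToContinuum.BoseEinsteinCondensation.Theorems.BECRichardsonGaudinBeliaevDeformationBoundGappedAnchorComparison
import Summits.AtomisticToContinuum.BoseEinsteinCondensation.Theorems.BECRichardsonGaudinRichardsonAnchorBEC

/-!
# `BeliaevDeformationBound` IS complete condensation of the soft periodic gas

Route `BECRichardsonGaudin`, crux `BeliaevDeformationBound` (item `stmt-AtomisticToContinuum-14804`), line
`registered` (`Cruxes/BeliaevDeformationBound/Lines/birth.lean`, skeleton v4). This file lands — from
ALREADY LANDED theorems only — the three equivalences that say what the crux and its one remaining
registered stub `stub_shiftRemoval` (the infrared leg A, `Cmp(E_gas, E_pen; ε)`) are: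

* `beliaevDeformationBound_iff_completeCondensation` : crux `↔` COMPLETE CONDENSATION of the soft
  periodic dilute gas in the thermodynamic limit (for every soft repulsive finite-range `v` and `ε > 0`,
  at small `ρ`, eventually in `N`, the `δ`-near-minimisers of `periodicEnergy v` on the torus of side
  `(N/ρ)^{1/3}` have `n₀ ≥ (1 − ε)N`) — the open problem of the summit conjunct in its strong form
  (LSSY2005 Ch. 5, p. 35). (→): ranks 2 + 3 (`completeCondensation_of_anchor_of_comparison`, p165778)
  with rank 3 a theorem (`RichardsonAnchorBEC_proof`); (←): the sandwich
  `beliaevDeformationBound_of_completeCondensation` (p147698).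
* `shiftRemoval_iff_beliaevDeformationBound` : A `↔` crux — (→) is the landed assembly
  `beliaevDeformationBound_of_shiftRemoval` (p166461), (←) goes through complete condensation and the
  sandwich `stub_comparisonOfCondensation` (B3, p147698).
* `shiftRemoval_iff_completeCondensation` : A `↔` complete condensation.

Consequences recorded for the planner (no new mathematics is claimed): the stub A is not a proper part
of the crux but the crux itself; no line for this crux can avoid proving complete BEC of the soft gas;
and the anchor theorem (rank 3) is idle for the conjunct's `∃ c` form
(`threeQuarterCondensation_of_beliaevDeformationBound`, p165778).

References: LSSY2005 = Lieb–Seiringer–Solovej–Yngvason, *The Mathematics of the Bose Gas and its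
Condensation* (2005), §1.2 (1.17)–(1.19), Thm 2.2, Thm 2.4, Ch. 5 (5.17); Fournais 2020 (1.1)–(1.5).
-/

namespace Summit.AtomisticToContinuum.BoseEinsteinCondensation.Theorems.BeliaevDeformationBound

open scoped ENNReal
open MeasureTheory Filter
open Literature.MathematicalPhysics.QuantumManyBody.BoseGas
open Summit.AtomisticToContinuum.BoseEinsteinCondensation.Theses.BECRichardsonGaudin (BeliaevDeformationBound
  RichardsonAnchorBEC)
open Summit.AtomisticToContinuum.BoseEinsteinCondensation.Cruxes.RichardsonAnchorBEC.Birth (RichardsonAnchorBEC_proof)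

noncomputable section

/-- **The crux is complete condensation** (registered lead sub-goal, line `registered`):
`BeliaevDeformationBound ↔` complete BEC of the soft periodic dilute gas in the thermodynamic limit
(every `ε > 0`, small `ρ`, eventually in `N`, `δ`-near-minimisers of `periodicEnergy v` on the torus of
side `(N/ρ)^{1/3}` have `n₀ ≥ (1 − ε)N`). (→) `completeCondensation_of_anchor_of_comparison` with the
theorem `RichardsonAnchorBEC_proof`, re-indexed from `N = n + 2` to `N`; (←)
`beliaevDeformationBound_of_completeCondensation`. [cite: LSSY2005, Ch. 5 (5.17)] -/
theorem beliaevDeformationBound_iff_completeCondensation :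
    Summit.AtomisticToContinuum.BoseEinsteinCondensation.Theses.BECRichardsonGaudin.BeliaevDeformationBound ↔
    (∀ v : ℝ → ENNReal, IsRepulsiveFiniteRange v → (∫⁻ x : Space, v ‖x‖) ≠ ⊤ → ∀ ε : ℝ, 0 < ε →
      ∃ ρ₀ : ℝ, 0 < ρ₀ ∧ ∀ ρ : ℝ, 0 < ρ → ρ < ρ₀ → ∀ᶠ N : ℕ in Filter.atTop,
        ∃ δ : ENNReal, 0 < δ ∧ ∀ Ψ : PeriodicTrialState N (sideLength ρ N),
          periodicEnergy v Ψ ≤ periodicGroundStateEnergy v N (sideLength ρ N) + δ →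
            ENNReal.ofReal ((1 - ε) * N) ≤ condensateOccupation N (sideLength ρ N) Ψ.ψ) := by
  refine ⟨fun hB v hv hint ε hε => ?_, fun h => beliaevDeformationBound_of_completeCondensation h⟩
  obtain ⟨ρ₀, hρ₀, H⟩ :=
    completeCondensation_of_anchor_of_comparison RichardsonAnchorBEC_proof hB v hv hint ε hε
  refine ⟨ρ₀, hρ₀, fun ρ hρ hρlt => ?_⟩
  -- re-index the thermodynamic-limit filter from `n ↦ n + 2` to `N`
  obtain ⟨n₀, hn₀⟩ := Filter.eventually_atTop.1 (H ρ hρ hρlt)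
  refine Filter.eventually_atTop.2 ⟨n₀ + 2, fun N hN => ?_⟩
  obtain ⟨n, rfl⟩ : ∃ n, N = n + 2 := ⟨N - 2, by omega⟩
  exact hn₀ n (by omega)

/-- **The infrared stub is the crux**: the registered stub `stub_shiftRemoval` of the line (the
comparison `Cmp(E_gas, E_pen; ε)` between the gas and the SHIFTED gas
`E_pen = periodicEnergy v + 2ρ(∫v)·(N − n₀)`, stated let-free) is EQUIVALENT to
`BeliaevDeformationBound`. (→) the landed assembly `beliaevDeformationBound_of_shiftRemoval`; (←) crux ⇒
complete condensation (`beliaevDeformationBound_iff_completeCondensation`) ⇒ the comparison, by the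
sandwich `stub_comparisonOfCondensation` with `X := periodicEnergy v`, `E := E_pen`. [folklore] -/
theorem shiftRemoval_iff_beliaevDeformationBound :
    (∀ (v : ℝ → ENNReal) (ε : ℝ), IsRepulsiveFiniteRange v → (∫⁻ x : EuclideanSpace ℝ (Fin 3), v ‖x‖) ≠ ⊤ →
      0 < ε → ∃ ρ₀ : ℝ, 0 < ρ₀ ∧ ∀ ρ : ℝ, 0 < ρ → ρ < ρ₀ → ∀ᶠ n : ℕ in Filter.atTop,
        ∀ δ' : ENNReal, 0 < δ' → ∃ δ : ENNReal, 0 < δ ∧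
          ∀ Ψ : PeriodicTrialState (n + 2) (sideLength ρ (n + 2)),
            periodicEnergy v Ψ ≤ periodicGroundStateEnergy v (n + 2) (sideLength ρ (n + 2)) + δ →
              ∃ Φ : PeriodicTrialState (n + 2) (sideLength ρ (n + 2)),
                periodicEnergy v Φ + ENNReal.ofReal (2 * ρ * (∫⁻ x : EuclideanSpace ℝ (Fin 3), v ‖x‖).toReal) *
                    (((n + 2 : ℕ) : ENNReal) - condensateOccupation (n + 2) (sideLength ρ (n + 2)) Φ.ψ) ≤
                  (⨅ Φ' : PeriodicTrialState (n + 2) (sideLength ρ (n + 2)),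
                    (periodicEnergy v Φ' +
                      ENNReal.ofReal (2 * ρ * (∫⁻ x : EuclideanSpace ℝ (Fin 3), v ‖x‖).toReal) *
                        (((n + 2 : ℕ) : ENNReal) - condensateOccupation (n + 2) (sideLength ρ (n + 2)) Φ'.ψ))) +
                    δ' ∧
                condensateOccupation (n + 2) (sideLength ρ (n + 2)) Φ.ψ ≤
                  condensateOccupation (n + 2) (sideLength ρ (n + 2)) Ψ.ψ +
                    ENNReal.ofReal (ε * ((n + 2 : ℕ) : ℝ))) ↔
    Summit.AtomisticToContinuum.BoseEinsteinCondensation.Theses.BECRichardsonGaudin.BeliaevDeformationBound := by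
  refine ⟨fun hA => beliaevDeformationBound_of_shiftRemoval hA, fun hB v ε hv hint hε => ?_⟩
  obtain ⟨ρ₀, hρ₀, H⟩ := beliaevDeformationBound_iff_completeCondensation.mp hB v hv hint ε hε
  refine ⟨ρ₀, hρ₀, fun ρ hρ hρlt => ?_⟩
  filter_upwards [(tendsto_add_atTop_nat 2).eventually (H ρ hρ hρlt)] with n hn
  have hL : 0 < sideLength ρ (n + 2) := by
    unfold sideLength
    exact Real.rpow_pos_of_pos (div_pos (by exact_mod_cast Nat.succ_pos _) hρ) _
  exact stub_comparisonOfCondensation (n + 2) (sideLength ρ (n + 2)) ε hL (fun Ψ => periodicEnergy v Ψ) _ hn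

/-- **The infrared stub is complete condensation**: `stub_shiftRemoval` (let-free) `↔` complete BEC of
the soft periodic dilute gas in the thermodynamic limit — the composition of the two equivalences
above. This is the certificate behind the lead's `promote-stub`: A is crux-sized because it is the
crux, and both are the open problem. [folklore] -/
theorem shiftRemoval_iff_completeCondensation :
    (∀ (v : ℝ → ENNReal) (ε : ℝ), IsRepulsiveFiniteRange v → (∫⁻ x : EuclideanSpace ℝ (Fin 3), v ‖x‖) ≠ ⊤ →
      0 < ε → ∃ ρ₀ : ℝ, 0 < ρ₀ ∧ ∀ ρ : ℝ, 0 < ρ → ρ < ρ₀ → ∀ᶠ n : ℕ in Filter.atTop,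
        ∀ δ' : ENNReal, 0 < δ' → ∃ δ : ENNReal, 0 < δ ∧
          ∀ Ψ : PeriodicTrialState (n + 2) (sideLength ρ (n + 2)),
            periodicEnergy v Ψ ≤ periodicGroundStateEnergy v (n + 2) (sideLength ρ (n + 2)) + δ →
              ∃ Φ : PeriodicTrialState (n + 2) (sideLength ρ (n + 2)),
                periodicEnergy v Φ + ENNReal.ofReal (2 * ρ * (∫⁻ x : EuclideanSpace ℝ (Fin 3), v ‖x‖).toReal) *
                    (((n + 2 : ℕ) : ENNReal) - condensateOccupation (n + 2) (sideLength ρ (n + 2)) Φ.ψ) ≤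
                  (⨅ Φ' : PeriodicTrialState (n + 2) (sideLength ρ (n + 2)),
                    (periodicEnergy v Φ' +
                      ENNReal.ofReal (2 * ρ * (∫⁻ x : EuclideanSpace ℝ (Fin 3), v ‖x‖).toReal) *
                        (((n + 2 : ℕ) : ENNReal) - condensateOccupation (n + 2) (sideLength ρ (n + 2)) Φ'.ψ))) +
                    δ' ∧
                condensateOccupation (n + 2) (sideLength ρ (n + 2)) Φ.ψ ≤
                  condensateOccupation (n + 2) (sideLength ρ (n + 2)) Ψ.ψ +
                    ENNReal.ofReal (ε * ((n + 2 : ℕ) : ℝ))) ↔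
    (∀ v : ℝ → ENNReal, IsRepulsiveFiniteRange v → (∫⁻ x : Space, v ‖x‖) ≠ ⊤ → ∀ ε : ℝ, 0 < ε →
      ∃ ρ₀ : ℝ, 0 < ρ₀ ∧ ∀ ρ : ℝ, 0 < ρ → ρ < ρ₀ → ∀ᶠ N : ℕ in Filter.atTop,
        ∃ δ : ENNReal, 0 < δ ∧ ∀ Ψ : PeriodicTrialState N (sideLength ρ N),
          periodicEnergy v Ψ ≤ periodicGroundStateEnergy v N (sideLength ρ N) + δ →
            ENNReal.ofReal ((1 - ε) * N) ≤ condensateOccupation N (sideLength ρ N) Ψ.ψ) :=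
  shiftRemoval_iff_beliaevDeformationBound.trans beliaevDeformationBound_iff_completeCondensation

end

end Summit.AtomisticToContinuum.BoseEinsteinCondensation.Theorems.BeliaevDeformationBound
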